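import Mathlib
import Summits.Langlands.Langlands.Theses.QuadraticWindow
import Summits.Langlands.Langlands.Theorems.QuadraticWindowTwistNormalizationIndexTwo
import Summits.Langlands.Langlands.Theorems.QuadraticWindowTwistNormalizationKummer
import Summits.Langlands.Langlands.Theorems.QuadraticWindowTwistNormalizationSignChar
import Summits.Langlands.Langlands.Theorems.QuadraticWindowTwistNormalizationSeparating
import Summits.Langlands.Langlands.Theorems.QuadraticWindowTwistNormalizationTwistData
import Summits.Langlands.Langlands.Theorems.QuadraticWindowTwistNormalizationUntwist
import Literature.NumberTheory.GaloisRepresentations.ArtinCharacterReciprocityProofs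

/-!
# `TwistNormalization` (route `QuadraticWindow`, stmt-Langlands-10904): the parity normalisation
# of the polarization character is without loss of generality

`TwistNormalization_proof : QuadraticWindowA → (QuadraticWindowA without its two parity hypotheses)`.

Given a `τ`-polarized (w.r.t. the Artin avatar `e : Γ_{F₀} → GL_1(ℂ)` and `k : ℤ`), regular
algebraic, non-`τ`-invariant cuspidal `π` on `GL_n/F` (`F/F₀` quadratic, `F₀` totally real), twist
`π` by the finite-order Hecke character `μ = λ ϑ^j` (`j ∈ {0,1}`) of `F`, where

* `λ` is the Hecke character (Artin reciprocity for characters, `artinReciprocity_character_holds`)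
  of the sign-correcting Kummer character `θ_S` (`exists_signCharacter`): quadratic, unramified
  above `ℓ`, with `det e(res c) · θ_S(c) θ_S(θ_t c) = -1` at every complex conjugation `c`;
* `ϑ` is the separating character of odd prime exponent `p > n` (`exists_separatingCharacter`),
  and `j` is chosen so that `π ⊗ μ` is again not `τ`-invariant (`twist_not_invariant_or`).

Then `π ⊗ μ` is cuspidal regular algebraic, unramified above `ℓ`, `τ`-polarized with respect to
`(e ⊗ δ, k)` where `δ : Γ_{F₀} → ℂˣ` extends the `θ_t`-invariant character `E · (E ∘ θ_t)` of the
index-two subgroup `Γ_F` (`E = θ_S θ₁^j` the avatar of `μ`; `exists_character_extend`,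
`twisted_polarization`), and `e ⊗ δ` restricted to `Γ_F` is ODD at every real place of `F` — so
both parity hypotheses of `QuadraticWindowA` hold.  `QuadraticWindowA` gives `ρ_{π ⊗ μ}`, and
`ρ_π = ρ_{π⊗μ} ⊗ r_{μ⁻¹}` (`untwist_galoisRep`).  Arthur–Clozel 1989, Ch. 3 §6 (twisting and base
change); Barnet-Lamb–Gee–Geraghty–Taylor, arXiv:1010.2561 §2.1 (polarized pairs and their parity).
-/

set_option linter.dupNamespace false -- project-wide option (lakefile weak.linter.dupNamespace); `Summit.Langlands.Langlands` is the mandated namespace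

noncomputable section

open Literature.NumberTheory.GaloisRepresentations Literature.NumberTheory.Automorphic
open Field IsDedekindDomain NumberField Polynomial Filter
open scoped MatrixGroups Classical

namespace Summit.Langlands.Langlands.Theorems.TwistNormalization

section Small

variable {F : Type} [Field F]

/-- `det` of the rank-one representation `ofOpenKer θ` is `θ`. [folklore] -/
theorem det_ofOpenKer_apply (θ : absoluteGaloisGroup F →* ℂˣ) (hθ : IsOpen (θ.ker : Set (absoluteGaloisGroup F)))
    (σ : absoluteGaloisGroup F) :
    Matrix.GeneralLinearGroup.det (FramedGaloisRep.ofOpenKer θ hθ σ) = θ σ := by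
  refine Units.ext ?_
  rw [Matrix.GeneralLinearGroup.val_det_apply, Matrix.det_fin_one, FramedGaloisRep.ofOpenKer_apply_coe]

/-- A character of `Γ_F` of odd exponent is trivial at complex conjugations. [folklore] -/
theorem apply_eq_one_of_pow_odd_prime {θ : absoluteGaloisGroup F →* ℂˣ} {p : ℕ} (hp : p.Prime) (h2p : 2 < p)
    (hpow : ∀ g, θ g ^ p = 1) {φ : F →+* ℝ} {c : absoluteGaloisGroup F} (hc : IsComplexConjugation φ c) :
    θ c = 1 := by
  have h2 : θ c ^ 2 = 1 := by rw [← map_pow, hc.sq_eq_one, map_one]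
  have hgcd : p.gcd 2 = 1 := (Nat.Coprime.gcd_eq_one ((Nat.coprime_primes hp Nat.prime_two).mpr h2p.ne'))
  have := (pow_gcd_eq_one (a := θ c) (m := p) (n := 2)).mpr ⟨hpow c, h2⟩
  rwa [hgcd, pow_one] at this

end Small

section Main

variable {F₀ F : Type} [Field F₀] [NumberField F₀] [Field F] [NumberField F] [Algebra F₀ F]

/-- **The core of the twist normalisation.**  In the situation of `TwistNormalization` (all the
hypotheses of `QuadraticWindowA` except the two parity ones), let `θ_S` be the sign-correcting
character (for `det e`) and `μ` a finite-order Hecke character of `F`, unramified above `ℓ`, with a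
Galois avatar character `E` of open kernel agreeing with `θ_S` at complex conjugations, such that
`π ⊗ μ` is not `τ`-invariant.  Then `QuadraticWindowA` applied to `π ⊗ μ` and the avatar `e ⊗ δ`
(`δ` extending `E · (E ∘ θ_t)`) yields `ρ_{π⊗μ}`, and untwisting gives `ρ_π`. -/
theorem exists_galoisRep_of_twist (hA : Theses.QuadraticWindow.QuadraticWindowA)
    (τ : F ≃ₐ[F₀] F) (hTR : NumberField.IsTotallyReal F₀) (hdeg : Module.finrank F₀ F = 2) (hτ : τ ≠ 1)
    {t : absoluteGaloisGroup F₀}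
    (ht : haveI := isGalois_of_finrank_eq_two hdeg; absGaloisQuot F₀ F t = τ)
    (n : ℕ) (hcpt : isCompact_glFiniteIntegralLevel n F) (π : CuspidalAutomorphicRepData n F hcpt)
    (e : FramedGaloisRep F₀ ℂ 1) (k : ℤ) (hreg : π.1.IsRegularAlgebraic)
    (hpol : ∀ᶠ w in Filter.cofinite, ∀ (α β : Multiset ℂ) (c : ℂ), π.1.HasSatakeParamAt w α →
      π.1.HasSatakeParamAt (τ • w) β → e.HasFrobCharpolyAt (w.under (𝓞 F₀)) (X - C c) →
      β = α.map (fun a ↦ a⁻¹ * (c * ((w.under (𝓞 F₀)).residueCard : ℂ) ^ k) ^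
        w.asIdeal.inertiaDeg (𝓞 F₀)))
    (ℓ : ℕ) [Fact ℓ.Prime] (ι : PadicAlgCl ℓ ≃+* ℂ) (hℓ : ¬ ((ℓ : ℤ) ∣ NumberField.discr F))
    (hunr : ∀ w : HeightOneSpectrum (𝓞 F), ((ℓ : ℕ) : 𝓞 F) ∈ w.asIdeal → π.1.IsUnramifiedAt w)
    -- the sign-correcting character
    (θS : absoluteGaloisGroup F →* ℂˣ)
    (hSsign : haveI := isGalois_of_finrank_eq_two hdeg;
      ∀ (φ : F →+* ℝ) (c : absoluteGaloisGroup F), IsComplexConjugation φ c →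
        (FramedRep.det e).toMonoidHom (absGaloisRestrict F₀ F c) * (θS c * θS (absGaloisOuterConj F₀ F t c)) = -1)
    -- the twisting character and its avatar
    (μ : HeckeCharacter F) (hμ : μ.IsFiniteOrder)
    (hμunr : ∀ w : HeightOneSpectrum (𝓞 F), ((ℓ : ℕ) : 𝓞 F) ∈ w.asIdeal → μ.IsUnramifiedAt w)
    (E : absoluteGaloisGroup F →* ℂˣ) (hEopen : IsOpen (E.ker : Set (absoluteGaloisGroup F)))
    (hEcc : ∀ (φ : F →+* ℝ) (c : absoluteGaloisGroup F), IsComplexConjugation φ c → E c = θS c)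
    (hEfrob : ∀ᶠ w : HeightOneSpectrum (𝓞 F) in cofinite, ∀ 𝔓 ∈ w.primesAbove,
      ∀ Φ : absoluteGaloisGroup F, IsArithFrobAt (𝓞 F) Φ 𝔓 → ((E Φ : ℂˣ) : ℂ) = μ.valueAtUniformizer w)
    (hnti' : ∃ᶠ w in Filter.cofinite, ∃ α β : Multiset ℂ, (π.twist μ hμ).1.HasSatakeParamAt w α ∧
      (π.twist μ hμ).1.HasSatakeParamAt (τ • w) β ∧ β ≠ α) :
    ∃ ρ : FramedGaloisRep F (PadicAlgCl ℓ) n, ρ.toGaloisRep.IsSemisimple ∧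
      ∀ᶠ w in Filter.cofinite, ∀ α : Multiset ℂ, π.1.HasSatakeParamAt w α →
        ρ.IsUnramifiedAt w ∧ ρ.HasFrobCharpolyAt w (arithFrobPolyOfSatake ι w.residueCard n α) := by
  haveI := isGalois_of_finrank_eq_two hdeg
  haveI : FiniteDimensional F₀ F := Module.finite_of_finrank_eq_succ hdeg
  set θe : absoluteGaloisGroup F₀ →* ℂˣ := (FramedRep.det e).toMonoidHom with hθe
  -- the `θ_{t⁻¹}`-invariant character `ξ = E · (E ∘ θ_t)` of `Γ_F` and its extension `δ`
  set ξ : absoluteGaloisGroup F →* ℂˣ := E * E.comp (absGaloisOuterConj F₀ F t).toMonoidHom with hξ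
  have hξapp : ∀ σ, ξ σ = E σ * E (absGaloisOuterConj F₀ F t σ) := fun _ => rfl
  have htt : t * t ∈ (absGaloisRestrict F₀ F).range :=
    (Subgroup.mul_mem_iff_of_index_two (isOpen_range_and_index_eq_two hdeg).2).2 Iff.rfl
  obtain ⟨s₀, hs₀⟩ := htt
  have hinv : ∀ σ, ξ (absGaloisOuterConj F₀ F t⁻¹ σ) = ξ σ := by
    intro σ
    rw [hξapp, hξapp, absGaloisOuterConj_apply_inv_apply, mul_comm]
    congr 1
    -- `θ_{t⁻¹} = θ_{(t t)⁻¹} ∘ θ_t` and `θ_{(t t)⁻¹}` is inner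
    have hs₀' : absGaloisRestrict F₀ F s₀ = t * t := hs₀
    have e1 : t⁻¹ = absGaloisRestrict F₀ F s₀⁻¹ * t := by rw [map_inv, hs₀']; group
    rw [e1, absGaloisOuterConj_mul_apply, absGaloisOuterConj_absGaloisRestrict_apply]
    simp only [map_mul, map_inv, inv_inv]
    exact inv_mul_cancel_comm _ _
  obtain ⟨δ, hδ⟩ := exists_character_extend hdeg hτ ht ξ hinv
  -- `det e · δ` has open kernel
  have hopen : IsOpen (((θe * δ).ker : Subgroup (absoluteGaloisGroup F₀)) : Set (absoluteGaloisGroup F₀)) := by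
    apply isOpen_ker_of_comp_absGaloisRestrict hdeg
    have h1 := isOpen_ker_det (FramedGaloisRep.restrictField F e)
    have h2 : IsOpen (((E.ker : Subgroup (absoluteGaloisGroup F)).comap
        (absGaloisOuterConj F₀ F t).toMonoidHom : Subgroup (absoluteGaloisGroup F)) : Set (absoluteGaloisGroup F)) :=
      hEopen.preimage (absGaloisOuterConj F₀ F t).continuous
    apply Subgroup.isOpen_mono (H₁ := (FramedRep.det (FramedGaloisRep.restrictField F e)).toMonoidHom.ker ⊓
      (E.ker ⊓ (E.ker).comap (absGaloisOuterConj F₀ F t).toMonoidHom))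
    · intro g hg
      simp only [Subgroup.mem_inf, Subgroup.mem_comap, MonoidHom.mem_ker] at hg
      obtain ⟨hg1, hg2, hg3⟩ := hg
      rw [MonoidHom.mem_ker, MonoidHom.comp_apply, MonoidHom.mul_apply]
      change θe (absGaloisRestrict F₀ F g) * δ (absGaloisRestrict F₀ F g) = 1
      rw [hδ, hξapp, hg2, show E (absGaloisOuterConj F₀ F t g) = 1 from hg3, mul_one, mul_one]
      exact hg1
    · exact h1.inter (hEopen.inter h2)
  set e' : FramedGaloisRep F₀ ℂ 1 := FramedGaloisRep.ofOpenKer (θe * δ) hopen with he'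
  -- hypotheses of `QuadraticWindowA` for `π ⊗ μ` and `e'`
  have hreg' : (π.twist μ hμ).1.IsRegularAlgebraic := twist_isRegularAlgebraic hreg μ hμ
  have hpol' := twisted_polarization hdeg ht π.1 e k hpol μ hμ E hEfrob δ
    (fun σ => by rw [hδ, hξapp]) hopen
  have hodd' : (e'.restrictField F).IsOdd := by
    intro φ c hc
    have hc' : IsComplexConjugation (φ.comp ((absGaloisQuot F₀ F t⁻¹ : F ≃ₐ[F₀] F) : F →+* F))
        (absGaloisOuterConj F₀ F t c) := isComplexConjugation_absGaloisOuterConj t hc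
    rw [FramedGaloisRep.restrictField_apply, he', det_ofOpenKer_apply, MonoidHom.mul_apply, hδ, hξapp,
      hEcc φ c hc, hEcc _ _ hc']
    exact hSsign φ c hc
  have hunr' : ∀ w : HeightOneSpectrum (𝓞 F), ((ℓ : ℕ) : 𝓞 F) ∈ w.asIdeal →
      (π.twist μ hμ).1.IsUnramifiedAt w := fun w hw => twist_isUnramifiedAt (hunr w hw) hμ (hμunr w hw)
  -- apply the target and untwist
  obtain ⟨ρ', hss, hρ'⟩ := hA F₀ F τ hTR hdeg hτ n hcpt (π.twist μ hμ) e' k hreg' hpol' (Or.inl hodd')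
    (fun _ => hodd') hnti' ℓ ι hℓ hunr'
  exact untwist_galoisRep π.1 μ hμ ι ρ' hss hρ'

end Main

/-- **`TwistNormalization` (stmt-Langlands-10904) holds**: the two parity hypotheses of
`QuadraticWindowA` (constancy of `w ↦ det e(c_w)` on the real places of `F`, and oddness for odd
`n`) are without loss of generality — twist `π` by a finite-order Hecke character `μ = λ ϑ^j` of
`F` (sign-correcting quadratic `λ`, separating `ϑ` of prime exponent `p > n`, `j ∈ {0,1}` making
`π ⊗ μ` non-`τ`-invariant), apply `QuadraticWindowA` to `π ⊗ μ` with the avatar `e ⊗ δ`, and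
untwist.  Arthur–Clozel 1989, Ch. 3 §6; Barnet-Lamb–Gee–Geraghty–Taylor (arXiv:1010.2561) §2.1. -/
theorem _root_.Summit.Langlands.Langlands.Theorems.TwistNormalization_proof :
    Summit.Langlands.Langlands.Theses.QuadraticWindow.TwistNormalization := by
  intro hA F₀ F _ _ _ _ _ τ hTR hdeg hτ n hcpt π e k hreg hpol hnti ℓ _ ι hℓ hunr
  classical
  haveI := isGalois_of_finrank_eq_two hdeg
  obtain ⟨t, ht⟩ := absGaloisQuot_surjective F₀ F τ
  -- the sign-correcting character and its Hecke character
  obtain ⟨θS, hSopen, -, hSunr, hSsign⟩ :=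
    exists_signCharacter hdeg hτ ht (FramedRep.det e).toMonoidHom ℓ
  set S : FramedGaloisRep F ℂ 1 := FramedGaloisRep.ofOpenKer θS hSopen with hS
  obtain ⟨lam, hlamfin, hlam⟩ := artinReciprocity_character_holds F S
  have hSunr' : ∀ w : HeightOneSpectrum (𝓞 F), ((ℓ : ℕ) : 𝓞 F) ∈ w.asIdeal → S.IsUnramifiedAt w :=
    fun w hw => (FramedGaloisRep.isUnramifiedAt_ofOpenKer_iff θS hSopen w).mpr (hSunr w hw)
  have hlamunr : ∀ w : HeightOneSpectrum (𝓞 F), ((ℓ : ℕ) : 𝓞 F) ∈ w.asIdeal → lam.IsUnramifiedAt w :=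
    fun w hw => (hlam w (hSunr' w hw)).1
  have hlamfrob : ∀ᶠ w : HeightOneSpectrum (𝓞 F) in cofinite, ∀ 𝔓 ∈ w.primesAbove,
      ∀ Φ : absoluteGaloisGroup F, IsArithFrobAt (𝓞 F) Φ 𝔓 → ((θS Φ : ℂˣ) : ℂ) = lam.valueAtUniformizer w := by
    filter_upwards [FramedArtinRep.eventually_isUnramifiedAt S] with w hw
    exact (FramedGaloisRep.hasFrobCharpolyAt_ofOpenKer_iff θS hSopen w _).mp (hlam w hw).2
  -- a `τ`-moved place and the separating character
  obtain ⟨w₀, α₀, β₀, hα₀, hβ₀, hne₀⟩ := hnti.exists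
  have hw₀ : τ • w₀ ≠ w₀ := fun h => hne₀ (by
    rw [h] at hβ₀
    exact π.1.hasSatakeParamAt_unique_holds hβ₀ hα₀)
  obtain ⟨p, θ₁, ϑ, hϑfin, hp, hnp, h2p, h1open, h1pow, hϑunr, hϑfrob, hsep⟩ :=
    exists_separatingCharacter hdeg hτ ht ℓ n hw₀
  have hlamϑfin : (lam * ϑ).IsFiniteOrder := hlamfin.mul hϑfin
  -- one of the two twists is not `τ`-invariant
  rcases twist_not_invariant_or τ π.1 hnti lam ϑ hlamfin hlamϑfin hp hnp
      (hϑfrob.mono fun w hw => hw.2.1) hsep with h0 | h1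
  · exact exists_galoisRep_of_twist hA τ hTR hdeg hτ ht n hcpt π e k hreg hpol ℓ ι hℓ hunr θS hSsign
      lam hlamfin hlamunr θS hSopen (fun _ _ _ => rfl) hlamfrob h0
  · refine exists_galoisRep_of_twist hA τ hTR hdeg hτ ht n hcpt π e k hreg hpol ℓ ι hℓ hunr θS hSsign
      (lam * ϑ) hlamϑfin (fun w hw => isUnramifiedAt_mul (hlamunr w hw) (hϑunr w hw)) (θS * θ₁) ?_ ?_ ?_ h1
    · apply Subgroup.isOpen_mono (H₁ := θS.ker ⊓ θ₁.ker)
      · intro g hg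
        simp only [Subgroup.mem_inf, MonoidHom.mem_ker] at hg
        rw [MonoidHom.mem_ker, MonoidHom.mul_apply, hg.1, hg.2, mul_one]
      · exact hSopen.inter h1open
    · intro φ c hc
      rw [MonoidHom.mul_apply, apply_eq_one_of_pow_odd_prime hp h2p h1pow hc, mul_one]
    · filter_upwards [hlamfrob, hϑfrob] with w hw1 hw2
      intro 𝔓 h𝔓 Φ hΦ
      rw [MonoidHom.mul_apply, Units.val_mul, hw1 𝔓 h𝔓 Φ hΦ, hw2.2.2 𝔓 h𝔓 Φ hΦ,
        HeckeCharacter.valueAtUniformizer_mul]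

end Summit.Langlands.Langlands.Theorems.TwistNormalization

end
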